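import Summits.AtomisticToContinuum.HydrodynamicLimit.Theorems.OneFlightGossipEngineEnergyCurrentTailsSplitThermal
import Summits.AtomisticToContinuum.HydrodynamicLimit.Theorems.OneFlightGossipEngineEnergyCurrentTailsLossFloorGlue4L
import Summits.AtomisticToContinuum.HydrodynamicLimit.Theorems.OneFlightGossipEngineEnergyCurrentTailsLossIntensityFloor4LMixingGlue
import Summits.AtomisticToContinuum.HydrodynamicLimit.Theorems.OneFlightGossipEngineEnergyCurrentTailsFirstPartnerObjects
import Summits.AtomisticToContinuum.HydrodynamicLimit.Theses.WarmColdDichotomy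
import HarnessLib

/-!
# Crux `EnergyCurrentTails` (stmt-AtomisticToContinuum-9235), line `quartic-schur-ledger`:
# the composition from the LAGGED KINETIC-WINDOW mixing floor QMF₄ᴸ (seat c6 reshape A)

Companion of `…EnergyCurrentTailsSplitThermal.lean` (seat c5: `QMF₄ → S2a″ → EnergyCurrentTails`).  Seat c6 weakened the
lower primitive QMF₄ (thermal mixing floor on ALL windows — hence an instantaneous contact-scale floor as the window
shrinks) to QMF₄ᴸ (`EnergyCurrentTailsFirstPartner.QuarticMixingFloor4L`: ONE kinetic window `h_N = (N+1)^{-1/3}`, left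
integral over its first half), which is all the absorbing recursion consumes, and re-landed the glue: LIF₄ᴸ-glue
`stub_lossIntensityFloor4L_of_mixingFlux4L : QMF₄ᴸ → S2a″ → LIF₄ᴸ` and S1-glue₄ᴸ
`stub_lossFloor_of_lossIntensityFloor4L : S2 → LIF₄ᴸ → S1`.  Hence, exactly as in the c5 file:

* `EnergyCurrentTails_of_lossIntensityFloor4L : LIF₄ᴸ → S2a″ → EnergyCurrentTails`;
* `EnergyCurrentTails_of_mixingFloor4L : QMF₄ᴸ → S2a″ → EnergyCurrentTails` — the crux is CLOSED MODULO
  {QMF₄ᴸ, S2a″ `stub_energyFluxCeilingWindows`}; and since QMF₄ᴸ is in turn derived (registered skeleton, seat c6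
  reshape B) from the static first-partner floor T′, the realised share I′ and the sure pathwise transfer P, the crux
  is closed modulo {T′, I′, S2a″} once that glue lands (`EnergyCurrentTails_of_firstPartner`, to follow);
* `EnergyCurrentTails_warmCold_of_mixingFloor4L` — the same with the item's primary copy
  `WarmColdDichotomy.EnergyCurrentTails` (textually identical to the `OneFlightGossipEngine` copy).
-/

noncomputable section

open MeasureTheory Set Filter
open scoped ENNReal

namespace Summit.AtomisticToContinuum.HydrodynamicLimit.Theorems.QuarticSchurLedger

open Literature.MathematicalPhysics.KineticTheory Literature.Analysis.FluidPDE
open Summit.AtomisticToContinuum.HydrodynamicLimit.Theorems.EnergyCurrentTailsFirstPartner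

/-- **The quartic maximum principle from the LAGGED fourth-moment loss-intensity floor: LIF₄ᴸ → S2a″ →
`EnergyCurrentTails`** (line `quartic-schur-ledger`, crux stmt-AtomisticToContinuum-9235; seat c6 reshape A).  As
`EnergyCurrentTails_of_lossIntensityFloor4`, with S1 := S1-glue₄ᴸ(S2, LIF₄ᴸ) (`stub_lossFloor_of_lossIntensityFloor4L`). -/
theorem EnergyCurrentTails_of_lossIntensityFloor4L :
    (∀ (a₀ θ₀ : T3 → ℝ) (u₀ : T3 → V3), Continuous a₀ → Continuous θ₀ → Continuous u₀ → (∀ x, 0 < a₀ x) → (∀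
    x, 0 < θ₀ x) → ∃ σ₀ : ℝ, 0 < σ₀ ∧ ∀ σ : ℝ, 0 < σ → σ < σ₀ → ∀ T : ℝ, 0 < T → ∀ Φ : ((N : ℕ) →
    HardSphereFlow (Torus.geometry (Fin 3)) (hsDiameter σ N) (N + 1)), ∃ δ : ℝ, 0 < δ ∧ ∃ K₀ : ℝ, 0 ≤ K₀ ∧ ∃
    C : ℝ, 0 ≤ C ∧ ∃ N₀ : ℕ, ∀ N : ℕ, N₀ ≤ N → ∀ s : ℝ, 0 ≤ s → s + ((N : ℝ) + 1) ^ (-(1 / 3 : ℝ)) ≤ T →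
    ENNReal.ofReal (δ * (σ ^ 2 * ((N : ℝ) + 1) ^ (1 / 3 : ℝ))) * (∫⁻ r in Set.Ioc s (s + ((N : ℝ) + 1) ^
    (-(1 / 3 : ℝ)) / 2), (∫⁻ z, ENNReal.ofReal (((N : ℝ) + 1)⁻¹ * ∑ i : Fin (N + 1), (if K₀ < ‖((Φ N).flow r
    z i).2‖ then ‖((Φ N).flow r z i).2‖ ^ 4 else 0)) ∂(localGibbsLaw σ a₀ u₀ θ₀ N (Φ N)))) ≤ (∫⁻ z,
    ENNReal.ofReal (((N : ℝ) + 1)⁻¹ * (Φ N).collisionSum (Set.Ioc s (s + ((N : ℝ) + 1) ^ (-(1 / 3 : ℝ))))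
    (fun col => max (‖col.preVel.1‖ ^ 4 + ‖col.preVel.2‖ ^ 4 - ‖col.postVel.1‖ ^ 4 - ‖col.postVel.2‖ ^ 4) 0
    / 2) z) ∂(localGibbsLaw σ a₀ u₀ θ₀ N (Φ N))) + ENNReal.ofReal (C * (σ ^ 2 * ((N : ℝ) + 1) ^ (1 / 3 : ℝ)
    * (s + ((N : ℝ) + 1) ^ (-(1 / 3 : ℝ)) - s))) * (⨆ r ∈ Set.Icc s (s + ((N : ℝ) + 1) ^ (-(1 / 3 : ℝ))),
    (∫⁻ z, ENNReal.ofReal (((N : ℝ) + 1)⁻¹ * ∑ i : Fin (N + 1), ‖((Φ N).flow r z i).2‖ ^ 2) ∂(localGibbsLaw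
    σ a₀ u₀ θ₀ N (Φ N)))) * (⨆ r ∈ Set.Icc s (s + ((N : ℝ) + 1) ^ (-(1 / 3 : ℝ))), (∫⁻ z, ENNReal.ofReal
    (((N : ℝ) + 1)⁻¹ * ∑ i : Fin (N + 1), ‖((Φ N).flow r z i).2‖ ^ 3) ∂(localGibbsLaw σ a₀ u₀ θ₀ N (Φ N)))))
    → (∀ (a₀ θ₀ : T3 → ℝ) (u₀ : T3 → V3), Continuous a₀ → Continuous θ₀ → Continuous u₀ → (∀ x, 0 < a₀ x) →
    (∀ x, 0 < θ₀ x) → ∃ σ₀ : ℝ, 0 < σ₀ ∧ ∀ σ : ℝ, 0 < σ → σ < σ₀ → ∀ T : ℝ, 0 < T → ∀ Φ : ((N : ℕ) →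
    HardSphereFlow (Torus.geometry (Fin 3)) (hsDiameter σ N) (N + 1)), ∃ C : ℝ, 0 ≤ C ∧ ∃ N₀ : ℕ, ∀ N : ℕ,
    N₀ ≤ N → ∀ s s' : ℝ, 0 ≤ s → s ≤ s' → s' ≤ T → (∫⁻ z, ENNReal.ofReal (((N : ℝ) + 1)⁻¹ * (Φ
    N).collisionSum (Set.Ioc s s') (fun col => ‖col.preVel.1‖ ^ 2 * ‖col.preVel.2‖ ^ 2) z) ∂(localGibbsLaw σ
    a₀ u₀ θ₀ N (Φ N))) ≤ ENNReal.ofReal (C * (σ ^ 2 * ((N : ℝ) + 1) ^ (1 / 3 : ℝ) * (s' - s))) * (⨆ r ∈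
    Set.Icc s s', (∫⁻ z, ENNReal.ofReal (((N : ℝ) + 1)⁻¹ * ∑ i : Fin (N + 1), ‖((Φ N).flow r z i).2‖ ^ 2)
    ∂(localGibbsLaw σ a₀ u₀ θ₀ N (Φ N)))) * (⨆ r ∈ Set.Icc s s', (∫⁻ z, ENNReal.ofReal (((N : ℝ) + 1)⁻¹ * ∑
    i : Fin (N + 1), ‖((Φ N).flow r z i).2‖ ^ 3) ∂(localGibbsLaw σ a₀ u₀ θ₀ N (Φ N))))) →
    Summit.AtomisticToContinuum.HydrodynamicLimit.Theses.OneFlightGossipEngine.EnergyCurrentTails := by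
  intro hLIF hW
  -- the two derived crux-frame stubs S2 (gain ceiling) and S1 (loss floor), from landed glue
  have h2 := stub_gainCeiling_of_energyFluxCeiling stub_quarticData (stub_energyFluxCeiling_of_windows hW)
  have h1 := stub_lossFloor_of_lossIntensityFloor4L h2 hLIF
  refine Summit.AtomisticToContinuum.HydrodynamicLimit.Theorems.LoschmidtTagging.stub_quarticDocking ?_
  -- C⁺: the N-uniform quartic moment along the flow before the first shock
  intro a₀ θ₀ u₀ ha hθ hu ha0 hθ0
  obtain ⟨σ₁, hσ₁, H1⟩ := h1 a₀ θ₀ u₀ ha hθ hu ha0 hθ0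
  obtain ⟨σ₂, hσ₂, H2⟩ := h2 a₀ θ₀ u₀ ha hθ hu ha0 hθ0
  obtain ⟨σ₃, hσ₃, H3⟩ := stub_quarticData a₀ θ₀ u₀ ha hθ hu ha0 hθ0
  refine ⟨min (min σ₁ σ₂) (min σ₃ (1 / 2)),
    lt_min (lt_min hσ₁ hσ₂) (lt_min hσ₃ (by norm_num)), ?_⟩
  intro σ hσ hσlt T ρ θ u hE Φ h0 t ht
  have hσ₁' : σ < σ₁ := lt_of_lt_of_le hσlt ((min_le_left _ _).trans (min_le_left _ _))
  have hσ₂' : σ < σ₂ := lt_of_lt_of_le hσlt ((min_le_left _ _).trans (min_le_right _ _))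
  have hσ₃' : σ < σ₃ := lt_of_lt_of_le hσlt ((min_le_right _ _).trans (min_le_left _ _))
  have hσh : σ < 1 / 2 := lt_of_lt_of_le hσlt ((min_le_right _ _).trans (min_le_right _ _))
  obtain ⟨τ, hτ, c, hc, hc1, A, hA, N₁, HS1⟩ := H1 σ hσ hσ₁' T ρ θ u hE Φ h0 t ht
  obtain ⟨D, hD, N₂, HS2⟩ := H2 σ hσ hσ₂' T ρ θ u hE Φ h0 t ht τ hτ (c / 4) (by positivity)
  obtain ⟨B, hB, N₃, HQ⟩ := H3 σ hσ hσ₃' Φ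
  refine ⟨2 * (max B (2 * A + 4 * D / c) + D), max N₁ (max N₂ N₃), fun N hN s hs => ?_⟩
  have hN₁ : N₁ ≤ N := le_trans (le_max_left _ _) hN
  have hN₂ : N₂ ≤ N := le_trans ((le_max_left _ _).trans (le_max_right _ _)) hN
  have hN₃ : N₃ ≤ N := le_trans ((le_max_right _ _).trans (le_max_right _ _)) hN
  obtain ⟨hQ0, B', hB'⟩ := HQ N hN₃
  have hh : 0 < τ * ((N : ℝ) + 1) ^ (-(1 / 3 : ℝ)) := by positivity
  exact absorbing_recursion
    (y := fun r => ∫⁻ z, ENNReal.ofReal (((N : ℝ) + 1)⁻¹ * ∑ i : Fin (N + 1), ‖((Φ N).flow r z i).2‖ ^ 4)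
      ∂(localGibbsLaw σ a₀ u₀ θ₀ N (Φ N)))
    (G := fun s s' => ∫⁻ z, ENNReal.ofReal (((N : ℝ) + 1)⁻¹ *
      (Φ N).collisionSum (Set.Ioc s s')
        (fun col => max (‖col.postVel.1‖ ^ 4 + ‖col.postVel.2‖ ^ 4
          - ‖col.preVel.1‖ ^ 4 - ‖col.preVel.2‖ ^ 4) 0 / 2) z) ∂(localGibbsLaw σ a₀ u₀ θ₀ N (Φ N)))
    (L := fun s s' => ∫⁻ z, ENNReal.ofReal (((N : ℝ) + 1)⁻¹ *
      (Φ N).collisionSum (Set.Ioc s s')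
        (fun col => max (‖col.preVel.1‖ ^ 4 + ‖col.preVel.2‖ ^ 4
          - ‖col.postVel.1‖ ^ 4 - ‖col.postVel.2‖ ^ 4) 0 / 2) z) ∂(localGibbsLaw σ a₀ u₀ θ₀ N (Φ N)))
    (t := t) hh hc hc1 hA hD (by positivity) le_rfl hB hB' hQ0
    (fun s₁ s₂ hs₁ hs₁₂ => stub_quarticLedger a₀ θ₀ u₀ σ hσ hσh N (Φ N) s₁ s₂ hs₁ hs₁₂)
    (HS1 N hN₁) (HS2 N hN₂) s hs

/-- **The crux from the lagged kinetic-window mixing floor and the flux ceiling: QMF₄ᴸ → S2a″ →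
`EnergyCurrentTails`** (seat c6 reshape A; QMF₄ᴸ = `EnergyCurrentTailsFirstPartner.QuarticMixingFloor4L` = the registered
stub `stub_quarticMixingFloor4L`).  Proof: the landed LIF₄ᴸ-glue `stub_lossIntensityFloor4L_of_mixingFlux4L` and
`EnergyCurrentTails_of_lossIntensityFloor4L`. -/
theorem EnergyCurrentTails_of_mixingFloor4L :
    Summit.AtomisticToContinuum.HydrodynamicLimit.Theorems.EnergyCurrentTailsFirstPartner.QuarticMixingFloor4L
    → (∀ (a₀ θ₀ : T3 → ℝ) (u₀ : T3 → V3), Continuous a₀ → Continuous θ₀ → Continuous u₀ → (∀ x, 0 < a₀ x) →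
    (∀ x, 0 < θ₀ x) → ∃ σ₀ : ℝ, 0 < σ₀ ∧ ∀ σ : ℝ, 0 < σ → σ < σ₀ → ∀ T : ℝ, 0 < T → ∀ Φ : ((N : ℕ) →
    HardSphereFlow (Torus.geometry (Fin 3)) (hsDiameter σ N) (N + 1)), ∃ C : ℝ, 0 ≤ C ∧ ∃ N₀ : ℕ, ∀ N : ℕ,
    N₀ ≤ N → ∀ s s' : ℝ, 0 ≤ s → s ≤ s' → s' ≤ T → (∫⁻ z, ENNReal.ofReal (((N : ℝ) + 1)⁻¹ * (Φ
    N).collisionSum (Set.Ioc s s') (fun col => ‖col.preVel.1‖ ^ 2 * ‖col.preVel.2‖ ^ 2) z) ∂(localGibbsLaw σ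
    a₀ u₀ θ₀ N (Φ N))) ≤ ENNReal.ofReal (C * (σ ^ 2 * ((N : ℝ) + 1) ^ (1 / 3 : ℝ) * (s' - s))) * (⨆ r ∈
    Set.Icc s s', (∫⁻ z, ENNReal.ofReal (((N : ℝ) + 1)⁻¹ * ∑ i : Fin (N + 1), ‖((Φ N).flow r z i).2‖ ^ 2)
    ∂(localGibbsLaw σ a₀ u₀ θ₀ N (Φ N)))) * (⨆ r ∈ Set.Icc s s', (∫⁻ z, ENNReal.ofReal (((N : ℝ) + 1)⁻¹ * ∑
    i : Fin (N + 1), ‖((Φ N).flow r z i).2‖ ^ 3) ∂(localGibbsLaw σ a₀ u₀ θ₀ N (Φ N))))) →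
    Summit.AtomisticToContinuum.HydrodynamicLimit.Theses.OneFlightGossipEngine.EnergyCurrentTails :=
  fun hQ hW => EnergyCurrentTails_of_lossIntensityFloor4L (stub_lossIntensityFloor4L_of_mixingFlux4L hQ hW) hW

/-- **The same with the item's primary copy `WarmColdDichotomy.EnergyCurrentTails`** (textually identical to the
`OneFlightGossipEngine` copy). -/
theorem EnergyCurrentTails_warmCold_of_mixingFloor4L :
    Summit.AtomisticToContinuum.HydrodynamicLimit.Theorems.EnergyCurrentTailsFirstPartner.QuarticMixingFloor4L
    → (∀ (a₀ θ₀ : T3 → ℝ) (u₀ : T3 → V3), Continuous a₀ → Continuous θ₀ → Continuous u₀ → (∀ x, 0 < a₀ x) →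
    (∀ x, 0 < θ₀ x) → ∃ σ₀ : ℝ, 0 < σ₀ ∧ ∀ σ : ℝ, 0 < σ → σ < σ₀ → ∀ T : ℝ, 0 < T → ∀ Φ : ((N : ℕ) →
    HardSphereFlow (Torus.geometry (Fin 3)) (hsDiameter σ N) (N + 1)), ∃ C : ℝ, 0 ≤ C ∧ ∃ N₀ : ℕ, ∀ N : ℕ,
    N₀ ≤ N → ∀ s s' : ℝ, 0 ≤ s → s ≤ s' → s' ≤ T → (∫⁻ z, ENNReal.ofReal (((N : ℝ) + 1)⁻¹ * (Φ
    N).collisionSum (Set.Ioc s s') (fun col => ‖col.preVel.1‖ ^ 2 * ‖col.preVel.2‖ ^ 2) z) ∂(localGibbsLaw σ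
    a₀ u₀ θ₀ N (Φ N))) ≤ ENNReal.ofReal (C * (σ ^ 2 * ((N : ℝ) + 1) ^ (1 / 3 : ℝ) * (s' - s))) * (⨆ r ∈
    Set.Icc s s', (∫⁻ z, ENNReal.ofReal (((N : ℝ) + 1)⁻¹ * ∑ i : Fin (N + 1), ‖((Φ N).flow r z i).2‖ ^ 2)
    ∂(localGibbsLaw σ a₀ u₀ θ₀ N (Φ N)))) * (⨆ r ∈ Set.Icc s s', (∫⁻ z, ENNReal.ofReal (((N : ℝ) + 1)⁻¹ * ∑
    i : Fin (N + 1), ‖((Φ N).flow r z i).2‖ ^ 3) ∂(localGibbsLaw σ a₀ u₀ θ₀ N (Φ N))))) →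
    Summit.AtomisticToContinuum.HydrodynamicLimit.Theses.WarmColdDichotomy.EnergyCurrentTails :=
  fun hQ hW => EnergyCurrentTails_of_mixingFloor4L hQ hW

end Summit.AtomisticToContinuum.HydrodynamicLimit.Theorems.QuarticSchurLedger

end
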